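import Summits.QuantumFields.YangMills.Theorems.AllWindowsColdBoxBoxHighLineRestrictionCum3

/-!
# U5 ε₂-glue (G2c-3a): prelims for the D-truncation transfer of the FOURTH cumulant — eighth-moment integrability and the κ₄ transfer arithmetic

Free-hands helper of the κ-lineage (ym-line-fcl-p3 g27) for Steps D–E of the NEXT rung U5 (`stub_landauThirdOrder`, LINE-20, ⟨stmt-QuantumFields-24336⟩;
planner ym-idea-2 g18's `ASSEMBLY-U5.md` v0.1 §3: `f″(0)/2 = κ₄,₀(c₀, c_T; U, U)/2` with its CONNECTED cubic-pair term EXACTLY by Wick (L3c, LEAD g78 «ConnectedFourPoint») —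
under the FULL Gaussian `E₀`, i.e. after the D′-truncation transfer, which this file and `…RestrictionSetCum4` supply):

* §0 integrability of the squares of the ELEVEN raw monomials of ✓`Tilt.tiltCum4_eq_raw` (`G₁G₂P², G₁G₂P, G₁G₂, GᵢP², GᵢP, P², Gᵢ, P`) from the three EIGHTH moments
  `Integrable (Gᵢ⁸·gaussWeight)`, `Integrable (P⁸·gaussWeight)` (AM–GM `x²y²z²w² ≤ (x⁸+y⁸+z⁸+w⁸)/4`), and eighth moments of re-centred observables;
* §1 pure-real bookkeeping: `abs_sq_sub_sq_le_of`, ★`cum4_transfer_arith` — from `|r_V − e_V| ≤ 4η·S_V`, `|r_V| ≤ 2S_V`, `|e_V| ≤ S_V` the two raw 11-term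
  fourth-cumulant expressions differ by `≤ η·(4S₁₂₃₃ + 24S₃S₁₂₃ + 56S₃²S₁₂ + 12S₁S₂₃₃ + 12S₂S₁₃₃ + 112S₁S₃S₂₃ + 112S₂S₃S₁₃ + 56S₁S₂S₃₃ + 360S₁S₂S₃² + 12S₁₂S₃₃ + 24S₁₃S₂₃)`.

No definitions; standard axioms.  HONEST LABEL: helper-grade glue for U5 prep; U5, ⟨24004⟩, ⟨24336⟩ remain OPEN; route AllWindowsColdBox is DRAFT;
no crux, rung or summit is proved; the Yang–Mills mass gap is NOT proved by this file; no summit is proved by a line.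
-/

set_option autoImplicit false

noncomputable section

open MeasureTheory Set

namespace Summit.QuantumFields.YangMills.Theorems.AllWindowsColdBoxBoxHighLine

namespace GaussRestrict

variable {H : ℕ} {β : ℝ}

/-! ## §0 Integrability from eighth moments -/

/-- AM–GM for four squares: `x²y²z²w² ≤ (x⁸ + y⁸ + z⁸ + w⁸)/4`. -/
theorem sq_mul4_le (x y z w : ℝ) : x ^ 2 * y ^ 2 * z ^ 2 * w ^ 2 ≤ (x ^ 8 + y ^ 8 + z ^ 8 + w ^ 8) / 4 := by
  have h1 : x ^ 2 * y ^ 2 ≤ (x ^ 4 + y ^ 4) / 2 := by nlinarith [sq_nonneg (x ^ 2 - y ^ 2)]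
  have h2 : z ^ 2 * w ^ 2 ≤ (z ^ 4 + w ^ 4) / 2 := by nlinarith [sq_nonneg (z ^ 2 - w ^ 2)]
  have h3 : x ^ 4 * z ^ 4 ≤ (x ^ 8 + z ^ 8) / 2 := by nlinarith [sq_nonneg (x ^ 4 - z ^ 4)]
  have h4 : x ^ 4 * w ^ 4 ≤ (x ^ 8 + w ^ 8) / 2 := by nlinarith [sq_nonneg (x ^ 4 - w ^ 4)]
  have h5 : y ^ 4 * z ^ 4 ≤ (y ^ 8 + z ^ 8) / 2 := by nlinarith [sq_nonneg (y ^ 4 - z ^ 4)]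
  have h6 : y ^ 4 * w ^ 4 ≤ (y ^ 8 + w ^ 8) / 2 := by nlinarith [sq_nonneg (y ^ 4 - w ^ 4)]
  have hxy : 0 ≤ x ^ 2 * y ^ 2 := by positivity
  have hzw : 0 ≤ z ^ 2 * w ^ 2 := by positivity
  calc x ^ 2 * y ^ 2 * z ^ 2 * w ^ 2 = (x ^ 2 * y ^ 2) * (z ^ 2 * w ^ 2) := by ring
    _ ≤ ((x ^ 4 + y ^ 4) / 2) * ((z ^ 4 + w ^ 4) / 2) := mul_le_mul h1 h2 hzw (hxy.trans h1)
    _ = (x ^ 4 * z ^ 4 + x ^ 4 * w ^ 4 + y ^ 4 * z ^ 4 + y ^ 4 * w ^ 4) / 4 := by ring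
    _ ≤ _ := by linarith

/-- ★ **Integrability of the squared fourfold product from eighth moments.** -/
theorem integrable_sq_mul4_mul_gaussWeight (hβ : 0 < β) {X Y Z W : (LandauFree H → E3) → ℝ} (mX : Measurable X) (mY : Measurable Y)
    (mZ : Measurable Z) (mW : Measurable W) (hX : Integrable (fun a => X a ^ 8 * gaussWeight β H a))
    (hY : Integrable (fun a => Y a ^ 8 * gaussWeight β H a)) (hZ : Integrable (fun a => Z a ^ 8 * gaussWeight β H a))
    (hW : Integrable (fun a => W a ^ 8 * gaussWeight β H a)) :
    Integrable (fun a => (X a * Y a * Z a * W a) ^ 2 * gaussWeight β H a) := by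
  have hG : Integrable (fun a : LandauFree H → E3 => (X a ^ 8 + Y a ^ 8 + Z a ^ 8 + W a ^ 8) / 4 * gaussWeight β H a) :=
    ((((hX.add hY).add hZ).add hW).div_const 4).congr (Filter.Eventually.of_forall fun a => by simp only [Pi.add_apply]; ring)
  refine EdgeChartGaussian.integrable_mul_gaussWeight_of_abs_le H hβ ((((mX.mul mY).mul mZ).mul mW).pow_const 2) hG fun a => ?_
  rw [abs_of_nonneg (sq_nonneg _), show (X a * Y a * Z a * W a) ^ 2 = X a ^ 2 * Y a ^ 2 * Z a ^ 2 * W a ^ 2 by ring]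
  exact sq_mul4_le (X a) (Y a) (Z a) (W a)

/-- `1⁸·gaussWeight` is integrable. -/
theorem integrable_one_pow_eight_mul_gaussWeight (hβ : 0 < β) :
    Integrable (fun a : LandauFree H → E3 => (fun _ : LandauFree H → E3 => (1 : ℝ)) a ^ 8 * gaussWeight β H a) :=
  (EdgeChartGaussian.integrable_gaussWeight H hβ).congr (Filter.Eventually.of_forall fun a => by simp only [one_pow, one_mul])

/-- Squared triple product from eighth moments. -/
theorem integrable_sq_mul3_of_eight (hβ : 0 < β) {X Y Z : (LandauFree H → E3) → ℝ} (mX : Measurable X) (mY : Measurable Y) (mZ : Measurable Z)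
    (hX : Integrable (fun a => X a ^ 8 * gaussWeight β H a)) (hY : Integrable (fun a => Y a ^ 8 * gaussWeight β H a))
    (hZ : Integrable (fun a => Z a ^ 8 * gaussWeight β H a)) : Integrable (fun a => (X a * Y a * Z a) ^ 2 * gaussWeight β H a) :=
  (integrable_sq_mul4_mul_gaussWeight hβ mX mY mZ measurable_const hX hY hZ (integrable_one_pow_eight_mul_gaussWeight hβ)).congr
    (Filter.Eventually.of_forall fun a => by simp only [mul_one])

/-- Squared pair product from eighth moments. -/
theorem integrable_sq_mul2_of_eight (hβ : 0 < β) {X Y : (LandauFree H → E3) → ℝ} (mX : Measurable X) (mY : Measurable Y)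
    (hX : Integrable (fun a => X a ^ 8 * gaussWeight β H a)) (hY : Integrable (fun a => Y a ^ 8 * gaussWeight β H a)) :
    Integrable (fun a => (X a * Y a) ^ 2 * gaussWeight β H a) :=
  (integrable_sq_mul4_mul_gaussWeight hβ mX mY measurable_const measurable_const hX hY (integrable_one_pow_eight_mul_gaussWeight hβ)
    (integrable_one_pow_eight_mul_gaussWeight hβ)).congr (Filter.Eventually.of_forall fun a => by simp only [mul_one])

/-- Square from the eighth moment. -/
theorem integrable_sq_of_eight (hβ : 0 < β) {X : (LandauFree H → E3) → ℝ} (mX : Measurable X)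
    (hX : Integrable (fun a => X a ^ 8 * gaussWeight β H a)) : Integrable (fun a => X a ^ 2 * gaussWeight β H a) :=
  (integrable_sq_mul4_mul_gaussWeight hβ mX measurable_const measurable_const measurable_const hX (integrable_one_pow_eight_mul_gaussWeight hβ)
    (integrable_one_pow_eight_mul_gaussWeight hβ) (integrable_one_pow_eight_mul_gaussWeight hβ)).congr
    (Filter.Eventually.of_forall fun a => by simp only [mul_one])

/-- `(g − c)⁸ ≤ 128·(g⁸ + c⁸)`. -/
private theorem sub_pow_eight_le (g c : ℝ) : (g - c) ^ 8 ≤ 128 * (g ^ 8 + c ^ 8) := by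
  have h2 : (g - c) ^ 2 ≤ 2 * (g ^ 2 + c ^ 2) := by nlinarith [sq_nonneg (g + c)]
  have h0 : 0 ≤ (g - c) ^ 2 := sq_nonneg _
  have e : (g - c) ^ 8 = ((g - c) ^ 2) ^ 4 := by ring
  have h3 : ((g - c) ^ 2) ^ 4 ≤ (2 * (g ^ 2 + c ^ 2)) ^ 4 := pow_le_pow_left₀ h0 h2 4
  have hx : 0 ≤ g ^ 2 := sq_nonneg g
  have hy : 0 ≤ c ^ 2 := sq_nonneg c
  -- `(x + y)⁴ ≤ 8(x⁴ + y⁴)` for `x, y ≥ 0`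
  have hsq : (g ^ 2 + c ^ 2) ^ 2 ≤ 2 * ((g ^ 2) ^ 2 + (c ^ 2) ^ 2) := by nlinarith [sq_nonneg (g ^ 2 - c ^ 2)]
  have hsq' : ((g ^ 2) ^ 2 + (c ^ 2) ^ 2) ^ 2 ≤ 2 * ((g ^ 2) ^ 4 + (c ^ 2) ^ 4) := by nlinarith [sq_nonneg ((g ^ 2) ^ 2 - (c ^ 2) ^ 2)]
  have h4 : (g ^ 2 + c ^ 2) ^ 4 ≤ 8 * ((g ^ 2) ^ 4 + (c ^ 2) ^ 4) := by
    have hA : 0 ≤ (g ^ 2 + c ^ 2) ^ 2 := sq_nonneg _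
    calc (g ^ 2 + c ^ 2) ^ 4 = ((g ^ 2 + c ^ 2) ^ 2) ^ 2 := by ring
      _ ≤ (2 * ((g ^ 2) ^ 2 + (c ^ 2) ^ 2)) ^ 2 := pow_le_pow_left₀ hA hsq 2
      _ = 4 * ((g ^ 2) ^ 2 + (c ^ 2) ^ 2) ^ 2 := by ring
      _ ≤ 4 * (2 * ((g ^ 2) ^ 4 + (c ^ 2) ^ 4)) := by linarith
      _ = _ := by ring
  calc (g - c) ^ 8 = ((g - c) ^ 2) ^ 4 := e
    _ ≤ (2 * (g ^ 2 + c ^ 2)) ^ 4 := h3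
    _ = 16 * (g ^ 2 + c ^ 2) ^ 4 := by ring
    _ ≤ 16 * (8 * ((g ^ 2) ^ 4 + (c ^ 2) ^ 4)) := by linarith
    _ = 128 * (g ^ 8 + c ^ 8) := by ring

/-- Eighth moment of a re-centred observable from the eighth moment. -/
theorem integrable_sub_const_pow_eight_mul_gaussWeight (hβ : 0 < β) {G : (LandauFree H → E3) → ℝ} (hG : Measurable G)
    (iG : Integrable (fun a => G a ^ 8 * gaussWeight β H a)) (c : ℝ) :
    Integrable (fun a => (G a - c) ^ 8 * gaussWeight β H a) := by
  have hdom : Integrable (fun a : LandauFree H → E3 => 128 * (G a ^ 8 + c ^ 8) * gaussWeight β H a) := by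
    have hw := EdgeChartGaussian.integrable_gaussWeight H hβ
    exact ((iG.add (hw.const_mul (c ^ 8))).const_mul 128).congr (Filter.Eventually.of_forall fun a => by simp only [Pi.add_apply]; ring)
  refine EdgeChartGaussian.integrable_mul_gaussWeight_of_abs_le H hβ ((hG.sub measurable_const).pow_const 8) hdom fun a => ?_
  rw [abs_of_nonneg (by positivity)]
  exact sub_pow_eight_le (G a) c

/-! ## §1 Pure-real bookkeeping for the fourth cumulant -/

/-- `|r² − e²| ≤ δ·(Br + Be)` from `|r − e| ≤ δ`, `|r| ≤ Br`, `|e| ≤ Be`. -/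
theorem abs_sq_sub_sq_le_of {r e δ Br Be : ℝ} (d : |r - e| ≤ δ) (b : |r| ≤ Br) (c : |e| ≤ Be) : |r ^ 2 - e ^ 2| ≤ δ * (Br + Be) := by
  have e1 : r ^ 2 - e ^ 2 = (r - e) * (r + e) := by ring
  rw [e1, abs_mul]
  exact mul_le_mul d ((abs_add_le _ _).trans (add_le_add b c)) (abs_nonneg _) ((abs_nonneg _).trans d)

/-- `|r²| ≤ Br²` from `|r| ≤ Br` (private copy of a landed triviality with disjoint import closure). -/
private theorem abs_sq_le_of {r Br : ℝ} (b : |r| ≤ Br) : |r ^ 2| ≤ Br ^ 2 := by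
  rw [abs_pow]; exact pow_le_pow_left₀ (abs_nonneg _) b 2

/-- ★ **The κ₄ transfer arithmetic.**  Restricted raw moments `r_V`, full raw moments `e_V`, square-root sizes `S_V` for the eleven monomials
`V ∈ {1233, 123, 12, 233, 133, 23, 13, 33, 1, 2, 3}` (digits = slots `G₁ G₂ P P`): from `|r_V − e_V| ≤ 4η·S_V`, `|r_V| ≤ 2S_V`, `|e_V| ≤ S_V` the two raw
fourth-cumulant expressions (shape of ✓`Tilt.tiltCum4_eq_raw`) differ by at most
`η·(4S₁₂₃₃ + 24S₃S₁₂₃ + 56S₃²S₁₂ + 12S₁S₂₃₃ + 12S₂S₁₃₃ + 112S₁S₃S₂₃ + 112S₂S₃S₁₃ + 56S₁S₂S₃₃ + 360S₁S₂S₃² + 12S₁₂S₃₃ + 24S₁₃S₂₃)`. -/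
theorem cum4_transfer_arith
    {η S₁ S₂ S₃ S₁₂ S₁₃ S₂₃ S₃₃ S₁₂₃ S₁₃₃ S₂₃₃ S₁₂₃₃ : ℝ}
    {r₁ r₂ r₃ r₁₂ r₁₃ r₂₃ r₃₃ r₁₂₃ r₁₃₃ r₂₃₃ r₁₂₃₃ e₁ e₂ e₃ e₁₂ e₁₃ e₂₃ e₃₃ e₁₂₃ e₁₃₃ e₂₃₃ e₁₂₃₃ : ℝ}
    (d₁ : |r₁ - e₁| ≤ 4 * η * S₁) (d₂ : |r₂ - e₂| ≤ 4 * η * S₂) (d₃ : |r₃ - e₃| ≤ 4 * η * S₃) (d₁₂ : |r₁₂ - e₁₂| ≤ 4 * η * S₁₂)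
    (d₁₃ : |r₁₃ - e₁₃| ≤ 4 * η * S₁₃) (d₂₃ : |r₂₃ - e₂₃| ≤ 4 * η * S₂₃) (d₃₃ : |r₃₃ - e₃₃| ≤ 4 * η * S₃₃)
    (d₁₂₃ : |r₁₂₃ - e₁₂₃| ≤ 4 * η * S₁₂₃) (d₁₃₃ : |r₁₃₃ - e₁₃₃| ≤ 4 * η * S₁₃₃) (d₂₃₃ : |r₂₃₃ - e₂₃₃| ≤ 4 * η * S₂₃₃)
    (d₁₂₃₃ : |r₁₂₃₃ - e₁₂₃₃| ≤ 4 * η * S₁₂₃₃)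
    (b₂ : |r₂| ≤ 2 * S₂) (b₃ : |r₃| ≤ 2 * S₃) (b₁₂ : |r₁₂| ≤ 2 * S₁₂) (b₁₃ : |r₁₃| ≤ 2 * S₁₃) (b₂₃ : |r₂₃| ≤ 2 * S₂₃)
    (b₃₃ : |r₃₃| ≤ 2 * S₃₃) (b₁₂₃ : |r₁₂₃| ≤ 2 * S₁₂₃) (b₁₃₃ : |r₁₃₃| ≤ 2 * S₁₃₃) (b₂₃₃ : |r₂₃₃| ≤ 2 * S₂₃₃)
    (c₁ : |e₁| ≤ S₁) (c₂ : |e₂| ≤ S₂) (c₃ : |e₃| ≤ S₃) (c₁₂ : |e₁₂| ≤ S₁₂) (c₁₃ : |e₁₃| ≤ S₁₃) :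
    |(r₁₂₃₃ - 2 * r₃ * r₁₂₃ + 2 * r₃ ^ 2 * r₁₂ - r₁ * r₂₃₃ - r₂ * r₁₃₃ + 4 * (r₁ * r₃ * r₂₃) + 4 * (r₂ * r₃ * r₁₃) +
          2 * (r₁ * r₂ * r₃₃) - 6 * (r₁ * r₂ * r₃ ^ 2) - r₁₂ * r₃₃ - 2 * (r₁₃ * r₂₃)) -
        (e₁₂₃₃ - 2 * e₃ * e₁₂₃ + 2 * e₃ ^ 2 * e₁₂ - e₁ * e₂₃₃ - e₂ * e₁₃₃ + 4 * (e₁ * e₃ * e₂₃) + 4 * (e₂ * e₃ * e₁₃) +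
          2 * (e₁ * e₂ * e₃₃) - 6 * (e₁ * e₂ * e₃ ^ 2) - e₁₂ * e₃₃ - 2 * (e₁₃ * e₂₃))| ≤
      η * (4 * S₁₂₃₃ + 24 * (S₃ * S₁₂₃) + 56 * (S₃ ^ 2 * S₁₂) + 12 * (S₁ * S₂₃₃) + 12 * (S₂ * S₁₃₃) + 112 * (S₁ * S₃ * S₂₃) +
        112 * (S₂ * S₃ * S₁₃) + 56 * (S₁ * S₂ * S₃₃) + 360 * (S₁ * S₂ * S₃ ^ 2) + 12 * (S₁₂ * S₃₃) + 24 * (S₁₃ * S₂₃)) := by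
  -- the square `r₃²` as a derived monomial
  have ds : |r₃ ^ 2 - e₃ ^ 2| ≤ 12 * η * S₃ ^ 2 := by
    have h := abs_sq_sub_sq_le_of d₃ b₃ c₃
    calc |r₃ ^ 2 - e₃ ^ 2| ≤ 4 * η * S₃ * (2 * S₃ + S₃) := h
      _ = 12 * η * S₃ ^ 2 := by ring
  have bs : |r₃ ^ 2| ≤ 4 * S₃ ^ 2 := by
    have h := abs_sq_le_of b₃
    calc |r₃ ^ 2| ≤ (2 * S₃) ^ 2 := h
      _ = 4 * S₃ ^ 2 := by ring
  -- the eleven term differences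
  have t2 := abs_mul_sub_mul_le_of d₃ b₁₂₃ c₃ d₁₂₃
  have t3 := abs_mul3_sub_mul3_le_of d₃ d₃ d₁₂ b₃ b₁₂ c₃ c₃
  have t4 := abs_mul_sub_mul_le_of d₁ b₂₃₃ c₁ d₂₃₃
  have t5 := abs_mul_sub_mul_le_of d₂ b₁₃₃ c₂ d₁₃₃
  have t6 := abs_mul3_sub_mul3_le_of d₁ d₃ d₂₃ b₃ b₂₃ c₁ c₃
  have t7 := abs_mul3_sub_mul3_le_of d₂ d₃ d₁₃ b₃ b₁₃ c₂ c₃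
  have t8 := abs_mul3_sub_mul3_le_of d₁ d₂ d₃₃ b₂ b₃₃ c₁ c₂
  have t9 := abs_mul3_sub_mul3_le_of d₁ d₂ ds b₂ bs c₁ c₂
  have t10 := abs_mul_sub_mul_le_of d₁₂ b₃₃ c₁₂ d₃₃
  have t11 := abs_mul_sub_mul_le_of d₁₃ b₂₃ c₁₃ d₂₃
  have e3 : r₃ ^ 2 * r₁₂ - e₃ ^ 2 * e₁₂ = r₃ * r₃ * r₁₂ - e₃ * e₃ * e₁₂ := by ring
  rw [← e3] at t3
  obtain ⟨l1, u1⟩ := abs_le.1 d₁₂₃₃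
  obtain ⟨l2, u2⟩ := abs_le.1 t2
  obtain ⟨l3, u3⟩ := abs_le.1 t3
  obtain ⟨l4, u4⟩ := abs_le.1 t4
  obtain ⟨l5, u5⟩ := abs_le.1 t5
  obtain ⟨l6, u6⟩ := abs_le.1 t6
  obtain ⟨l7, u7⟩ := abs_le.1 t7
  obtain ⟨l8, u8⟩ := abs_le.1 t8
  obtain ⟨l9, u9⟩ := abs_le.1 t9
  obtain ⟨l10, u10⟩ := abs_le.1 t10
  obtain ⟨l11, u11⟩ := abs_le.1 t11
  rw [abs_le]
  constructor <;> linarith [l1, u1, l2, u2, l3, u3, l4, u4, l5, u5, l6, u6, l7, u7, l8, u8, l9, u9, l10, u10, l11, u11]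

end GaussRestrict

end Summit.QuantumFields.YangMills.Theorems.AllWindowsColdBoxBoxHighLine

end
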